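import Mathlib.Probability.Independence.Basic
import Mathlib.MeasureTheory.MeasurableSpace.Instances
import Mathlib.Data.ENat.Lattice
import HarnessLib

/-!
# Laws and independence of `ℕ∞`-valued counts from their lower tails

Generic measure-theoretic lemmas for random variables with values in `ℕ∞` (carrying the discrete
σ-field `⊤`), used to pass from the probabilities of the events `{N ≤ k}`, `k : ℕ`, to laws and
independence of counting variables `N` (Kingman, *Poisson Processes* (1993), §2.1: the counts
`N(A) ∈ {0, 1, …, ∞}` of a random countable set):

* `Literature.Probability.Process.ENat.generateFrom_range_Iic` — the lower sets `{x | x ≤ a}`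
  generate the discrete σ-field of `ℕ∞`;
* `Literature.Probability.Process.iIndepFun_enat_of_measure_biInter_setOf_le` — `ℕ∞`-valued
  random variables whose lower-tail events `{N_i ≤ a_i}` have multiplicative probabilities are
  independent (π-system argument);
* `Literature.Probability.Process.map_enat_eq_map_natCast` — if `P{N ≤ k} = μ{0, …, k}` for all
  `k : ℕ` and a probability measure `μ` on `ℕ`, then the law of `N` is `μ` pushed to `ℕ∞` (in
  particular `N < ∞` a.s.);
* `Literature.Probability.Process.ae_eq_top_of_measure_setOf_le` — if `P{N ≤ k} = 0` for all
  `k : ℕ` then `N = ∞` a.s.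
-/

noncomputable section

open MeasureTheory ProbabilityTheory Set Filter Topology
open scoped ENNReal

namespace Literature.Probability.Process

/-! ### The lower sets generate the σ-field of `ℕ∞` -/

/-- A singleton of `ℕ∞` in terms of lower sets: `{a} = Iic a ∖ ⋃_{k : ℕ, k < a} Iic k`. [folklore] -/
theorem ENat.singleton_eq_Iic_diff (a : ℕ∞) :
    ({a} : Set ℕ∞) = Iic a \ ⋃ (k : ℕ) (_ : (k : ℕ∞) < a), Iic (k : ℕ∞) := by
  ext x
  simp only [mem_singleton_iff, Set.mem_sdiff, mem_Iic, mem_iUnion, exists_prop, not_exists, not_and]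
  constructor
  · rintro rfl
    exact ⟨le_rfl, fun k hk hle ↦ (lt_irrefl _ (hle.trans_lt hk)).elim⟩
  · rintro ⟨hle, h⟩
    rcases hle.eq_or_lt with h' | hlt
    · exact h'
    · exfalso
      have hx : x ≠ ⊤ := hlt.ne_top
      have hxk : x = (x.toNat : ℕ∞) := (ENat.coe_toNat hx).symm
      exact h x.toNat (hxk ▸ hlt) hxk.le

/-- **The lower sets `{x | x ≤ a}` generate the (discrete) σ-field of `ℕ∞`.** [folklore] -/
theorem ENat.generateFrom_range_Iic :
    MeasurableSpace.generateFrom (range (Iic : ℕ∞ → Set ℕ∞)) = (⊤ : MeasurableSpace ℕ∞) := by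
  refine le_antisymm le_top fun t _ ↦ ?_
  have hIic : ∀ a : ℕ∞, MeasurableSet[MeasurableSpace.generateFrom (range (Iic : ℕ∞ → Set ℕ∞))] (Iic a) :=
    fun a ↦ MeasurableSpace.measurableSet_generateFrom ⟨a, rfl⟩
  have hsingle : ∀ a : ℕ∞, MeasurableSet[MeasurableSpace.generateFrom (range (Iic : ℕ∞ → Set ℕ∞))] {a} := by
    intro a
    rw [ENat.singleton_eq_Iic_diff]
    exact (hIic a).diff (MeasurableSet.iUnion fun k ↦ MeasurableSet.iUnion fun _ ↦ hIic k)
  rw [← biUnion_of_singleton t]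
  exact MeasurableSet.biUnion t.to_countable fun a _ ↦ hsingle a

/-! ### Independence from the lower tails -/

section Indep

variable {Ω ι : Type*} [MeasurableSpace Ω] {P : Measure Ω}

/-- **Independence of `ℕ∞`-valued random variables from their lower tails**: if for every finite
set of indices `S` and levels `a_i ∈ ℕ∞` the probability of `⋂_{i ∈ S} {N_i ≤ a_i}` is the
product of the probabilities of the `{N_i ≤ a_i}`, then the `N_i` are independent (the lower sets
form a π-system generating the σ-field of `ℕ∞`). [folklore] -/
theorem iIndepFun_enat_of_measure_biInter_setOf_le {N : ι → Ω → ℕ∞} (hN : ∀ i, Measurable (N i))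
    (h : ∀ (S : Finset ι) (a : ι → ℕ∞),
      P (⋂ i ∈ S, {ω | N i ω ≤ a i}) = ∏ i ∈ S, P {ω | N i ω ≤ a i}) :
    iIndepFun N P := by
  classical
  rw [iIndepFun_iff_iIndep]
  refine iIndepSets.iIndep (fun i ↦ (hN i).comap_le)
    (fun i ↦ {A | ∃ t ∈ range (Iic : ℕ∞ → Set ℕ∞), N i ⁻¹' t = A})
    (fun i ↦ isPiSystem_Iic.comap (N i)) (fun i ↦ ?_) ?_
  · -- the comap σ-field is generated by the preimages of the lower sets
    change MeasurableSpace.comap (N i) ⊤ = _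
    rw [← ENat.generateFrom_range_Iic, MeasurableSpace.comap_generateFrom]
    rfl
  · rw [iIndepSets_iff]
    intro S f hf
    choose! t ht hft using hf
    choose! a ha using ht
    have hfi : ∀ i ∈ S, f i = {ω | N i ω ≤ a i} := fun i hi ↦ by
      rw [← hft i hi, ← ha i hi]
      rfl
    rw [Set.iInter₂_congr hfi, Finset.prod_congr rfl fun i hi ↦ by rw [hfi i hi]]
    exact h S a

end Indep

/-! ### Laws from the lower tails -/

section Law

variable {Ω : Type*} [MeasurableSpace Ω] {P : Measure Ω} {N : Ω → ℕ∞}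

omit [MeasurableSpace Ω] in
/-- `{N ≠ ∞} = ⋃_k {N ≤ k}`. [folklore] -/
theorem ENat.setOf_ne_top_eq_iUnion (N : Ω → ℕ∞) : {ω | N ω ≠ ⊤} = ⋃ k : ℕ, {ω | N ω ≤ k} := by
  ext ω
  simp only [ne_eq, mem_setOf_eq, mem_iUnion]
  constructor
  · intro h
    exact ⟨(N ω).toNat, (ENat.coe_toNat h).symm.le⟩
  · rintro ⟨k, hk⟩
    exact (hk.trans_lt (ENat.coe_lt_top k)).ne

omit [MeasurableSpace Ω] in
/-- `{N = k + 1} = {N ≤ k + 1} ∖ {N ≤ k}`. [folklore] -/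
theorem ENat.setOf_eq_succ (N : Ω → ℕ∞) (k : ℕ) :
    {ω | N ω = (k + 1 : ℕ)} = {ω | N ω ≤ (k + 1 : ℕ)} \ {ω | N ω ≤ k} := by
  ext ω
  simp only [mem_setOf_eq, Set.mem_sdiff, not_le, Nat.cast_add, Nat.cast_one]
  constructor
  · intro h
    simp only [h, le_refl, true_and]
    exact_mod_cast Nat.lt_succ_self k
  · rintro ⟨h1, h2⟩
    exact le_antisymm h1 ((ENat.add_one_le_iff (ENat.coe_ne_top k)).2 h2)

/-- **If `N = ∞` has vanishing lower tails then `N = ∞` a.s.**: `P{N ≤ k} = 0` for all `k : ℕ`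
implies `N = ⊤` almost surely. [folklore] -/
theorem ae_eq_top_of_measure_setOf_le (h : ∀ k : ℕ, P {ω | N ω ≤ k} = 0) : ∀ᵐ ω ∂P, N ω = ⊤ := by
  rw [ae_iff]
  change P {ω | N ω ≠ ⊤} = 0
  rw [ENat.setOf_ne_top_eq_iUnion]
  exact measure_iUnion_null h

/-- Equal lower tails give equal probabilities of being finite. [folklore] -/
theorem measure_setOf_ne_top_eq {μ : Measure ℕ}
    (h : ∀ k : ℕ, P {ω | N ω ≤ k} = μ (Iic k)) : P {ω | N ω ≠ ⊤} = μ univ := by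
  have h1 : Tendsto (fun k : ℕ ↦ P {ω | N ω ≤ k}) atTop (𝓝 (P (⋃ k : ℕ, {ω | N ω ≤ k}))) :=
    tendsto_measure_iUnion_atTop fun k k' hk ω (hω : N ω ≤ k) ↦ hω.trans (by exact_mod_cast hk)
  have h2 : Tendsto (fun k : ℕ ↦ μ (Iic k)) atTop (𝓝 (μ (⋃ k : ℕ, Iic k))) :=
    tendsto_measure_iUnion_atTop fun k k' hk ↦ Iic_subset_Iic.2 hk
  have huniv : (⋃ k : ℕ, Iic k) = (univ : Set ℕ) := eq_univ_of_forall fun k ↦ mem_iUnion.2 ⟨k, self_mem_Iic⟩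
  rw [ENat.setOf_ne_top_eq_iUnion, ← huniv]
  simp_rw [h] at h1
  exact tendsto_nhds_unique h1 h2

/-- **The law of an `ℕ∞`-valued random variable from its lower tails**: if `P{N ≤ k} = μ{0,…,k}`
for every `k : ℕ`, `μ` a probability measure on `ℕ`, then the law of `N` is the image of `μ` in
`ℕ∞` (so `N` is a.s. finite with law `μ`). [folklore] -/
theorem map_enat_eq_map_natCast [IsProbabilityMeasure P] (hN : Measurable N) {μ : Measure ℕ} [IsProbabilityMeasure μ]
    (h : ∀ k : ℕ, P {ω | N ω ≤ k} = μ (Iic k)) :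
    P.map N = μ.map ((↑) : ℕ → ℕ∞) := by
  have hmeas : Measurable ((↑) : ℕ → ℕ∞) := measurable_from_top
  refine Measure.ext_of_singleton fun a ↦ ?_
  rw [Measure.map_apply hN (measurableSet_singleton a), Measure.map_apply hmeas (measurableSet_singleton a)]
  induction a using ENat.recTopCoe with
  | top =>
    -- `N < ∞` a.s.
    have hpre : ((↑) : ℕ → ℕ∞) ⁻¹' {⊤} = ∅ := by
      ext k
      simp
    rw [hpre, measure_empty]
    have hfin : P {ω | N ω ≠ ⊤} = 1 := by rw [measure_setOf_ne_top_eq h, measure_univ]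
    have hcompl : N ⁻¹' {⊤} = {ω | N ω ≠ ⊤}ᶜ := by
      ext ω
      simp
    have hm' : MeasurableSet {ω | N ω ≠ ⊤} := (hN (measurableSet_singleton ⊤)).compl
    rw [hcompl, prob_compl_eq_one_sub hm', hfin, tsub_self]
  | coe k =>
    have hpre : ((↑) : ℕ → ℕ∞) ⁻¹' {(k : ℕ∞)} = {k} := by
      ext j
      simp
    rw [hpre]
    cases k with
    | zero =>
      have h0 : N ⁻¹' {((0 : ℕ) : ℕ∞)} = {ω | N ω ≤ (0 : ℕ)} := by
        ext ω
        simp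
      rw [h0, h 0]
      congr 1
      ext j
      simp
    | succ k =>
      change P {ω | N ω = (k + 1 : ℕ)} = _
      have hsub : {ω | N ω ≤ k} ⊆ {ω | N ω ≤ (k + 1 : ℕ)} :=
        fun ω (hω : N ω ≤ k) ↦ hω.trans (Nat.cast_le.2 k.le_succ)
      have hmk : MeasurableSet {ω | N ω ≤ k} := hN (MeasurableSet.of_discrete (s := Iic (k : ℕ∞)))
      have hIic : (Iic (k + 1) \ Iic k : Set ℕ) = {k + 1} := by
        ext j
        simp only [Set.mem_sdiff, mem_Iic, not_le, mem_singleton_iff]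
        omega
      rw [ENat.setOf_eq_succ, measure_sdiff hsub hmk.nullMeasurableSet (measure_ne_top _ _), h, h,
        ← measure_sdiff (Iic_subset_Iic.2 k.le_succ) (MeasurableSet.of_discrete (s := Iic k)).nullMeasurableSet
          (measure_ne_top _ _), hIic]

end Law

end Literature.Probability.Process

end
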